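import Summits.QuantumAdvantage.QuantumAdvantage.Theorems.SosSandwichCornerLiftC

/-!
# SosSandwichCornerLift — part D (4/4): VARIANCE SATURATION (item stmt-QuantumAdvantage-27571) and PB-AA ↔ top-band PB-AA

Tree twin of `decomp-qadv/lens-5/g20/CornerLift.lean` §10 (end) – §12, Prop-free: the statements are spelled
in the tree vocabulary (`PseudoBounded`, `boolVariance`, `influence`), which is `Iff.rfl` to the route items of
`Theses/SosSandwich.lean` (`pseudoBounded_iff`; `evalBool`, `boolAvg`, `flipBit` are the items' `ev`, `avg`,
`Function.update`).

* `varianceSaturation` — U: `∀ η > 0 ∃ a A > 0 ∀ p ∈ K_T (T ≥ 1), Var p ≥ ε > 0 → ∃ P ∈ K_{T'}`, `1 ≤ T' ≤ A (T/ε)^a`,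
  `Var P ≥ 1/4 - η`, `∀ j ∃ i, Inf_j P ≤ A (T/ε)^a · Inf_i p` (with `a = 22`).
* `varianceSaturation_served` — the SERVED SIGNATURE of ledger item `stmt-QuantumAdvantage-27571` verbatim (one
  line), proved by `varianceSaturation` (definitional junction).
* `pseudoBoundedAA_of_topBand`, `topBand_of_pseudoBoundedAA`, `pseudoBoundedAA_iff_topBand` — the rank-2 crux
  PB-AA (`SosSandwich.PseudoBoundedAA`, here in its `Iff.rfl` tree form) is EQUIVALENT to its one-parameter slice
  in the top variance band `Var p ≥ 1/4 - η` for a fixed absolute `η` (the Boolean-corner normal form).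
-/

set_option linter.dupNamespace false
set_option autoImplicit false

noncomputable section

open Finset
open Literature.Computability.QuantumComplexity
open Summit.QuantumAdvantage.QuantumAdvantage.Theorems.SosSandwich

namespace Summit.QuantumAdvantage.QuantumAdvantage.Theorems.SosSandwich.CornerLift

variable {N : ℕ}

section Saturation

open MvPolynomial

/-- The saturation cost constant `A(η)`. -/
def Asat (η : ℝ) : ℝ := ((65 : ℝ) ^ 2 * Kd + Kd ^ 2) * 2 ^ 22 / η ^ 22

/-- `Asat η > 0` for `η > 0`. [folklore] -/
theorem Asat_pos {η : ℝ} (hη : 0 < η) : 0 < Asat η := by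
  unfold Asat Kd; positivity

set_option maxHeartbeats 2000000 in
/-- **U PROVED: variance saturation inside `K`.** Every `p ∈ K_T` with `Var ≥ ε` lifts, at cost
`poly(T/ε)` (exponent `22`, constant `A(η)`), to a `P ∈ K_{T'}` in the top band `Var ≥ 1/4 - η` whose every
variable is a copy of a variable of `p` with `Inf_j P ≤ A (T/ε)^22 · Inf_i p`. [folklore] -/
theorem varianceSaturation :
    ∀ η : ℝ, 0 < η → ∃ (a : ℕ) (A : ℝ), 0 < A ∧
      ∀ (N T : ℕ) (p : MvPolynomial (Fin N) ℝ) (ε : ℝ), 1 ≤ T → PseudoBounded T p → 0 < ε →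
        ε ≤ boolVariance p →
          ∃ (N' T' : ℕ) (P : MvPolynomial (Fin N') ℝ), 1 ≤ T' ∧ (T' : ℝ) ≤ A * ((T : ℝ) / ε) ^ a ∧
            PseudoBounded T' P ∧ 1 / 4 - η ≤ boolVariance P ∧
            ∀ j : Fin N', ∃ i : Fin N, influence j P ≤ A * ((T : ℝ) / ε) ^ a * influence i p := by
  intro η hη0
  by_cases hη1 : η < 1 / 4
  · refine ⟨22, Asat η, Asat_pos hη0, ?_⟩
    intro N T p ε hT hp hε hεV
    obtain ⟨y₀, s, m, D, k, hy1, hy2, hs1, hm1, hD1, hsR, hmR, hDR, hvar⟩ :=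
      saturate hη0 hη1 hp hε hεV
    have hT' : (1 : ℝ) ≤ T := by exact_mod_cast hT
    have hηε : 0 < η * ε := mul_pos hη0 hε
    have hY : (y₀ : ℝ) ^ 22 ≤ 2 ^ 22 / (η * ε) ^ 22 := by
      rw [← div_pow]; exact pow_le_pow_left₀ (by positivity) hy2 22
    have hTT : (T : ℝ) ≤ T ^ 22 := le_self_pow₀ hT' (by norm_num)
    have hT22 : (1 : ℝ) ≤ T ^ 22 := one_le_pow₀ hT'
    have hy13 : (y₀ : ℝ) ^ 13 ≤ y₀ ^ 22 := pow_le_pow_right₀ hy1 (by norm_num)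
    have hKd := Kd_nonneg
    have eA : ∀ c : ℝ, c * (2 ^ 22 / (η * ε) ^ 22) * (T : ℝ) ^ 22 = (c * 2 ^ 22 / η ^ 22) * (T / ε) ^ 22 := by
      intro c
      have hη' : η ≠ 0 := hη0.ne'
      have hε' : ε ≠ 0 := hε.ne'
      rw [mul_pow, div_pow]
      field_simp
    have hA1 : (65 : ℝ) ^ 2 * Kd * 2 ^ 22 / η ^ 22 ≤ Asat η := by
      unfold Asat
      apply div_le_div_of_nonneg_right _ (by positivity)
      nlinarith [sq_nonneg Kd]
    have hA2 : Kd ^ 2 * 2 ^ 22 / η ^ 22 ≤ Asat η := by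
      unfold Asat
      apply div_le_div_of_nonneg_right _ (by positivity)
      nlinarith
    have hTε : 0 ≤ ((T : ℝ) / ε) ^ 22 := by positivity
    refine ⟨s * m * N, s * (m * (D * T)), ampPoly s m D k p, ?_, ?_, ampPoly_pseudoBounded hp s m D k,
      hvar, ?_⟩
    · exact Nat.mul_pos hs1 (Nat.mul_pos hm1 (Nat.mul_pos hD1 hT))
    · push_cast
      calc (s : ℝ) * (m * (D * T)) ≤ (65 * y₀) * ((65 * y₀) * (Kd * y₀ ^ 11 * T)) := by gcongr
        _ = 65 ^ 2 * Kd * y₀ ^ 13 * T := by ring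
        _ ≤ 65 ^ 2 * Kd * (2 ^ 22 / (η * ε) ^ 22) * T ^ 22 := by gcongr; exact hy13.trans hY
        _ = ((65 : ℝ) ^ 2 * Kd * 2 ^ 22 / η ^ 22) * (T / ε) ^ 22 := eA _
        _ ≤ Asat η * (T / ε) ^ 22 := mul_le_mul_of_nonneg_right hA1 hTε
    · intro j
      obtain ⟨i, hi⟩ := influence_ampPoly_le hp s m D k j
      refine ⟨i, hi.trans (mul_le_mul_of_nonneg_right ?_ (influence_nonneg i p))⟩
      calc (D : ℝ) ^ 2 ≤ (Kd * y₀ ^ 11) ^ 2 := pow_le_pow_left₀ (Nat.cast_nonneg _) hDR 2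
        _ = Kd ^ 2 * y₀ ^ 22 * 1 := by ring
        _ ≤ Kd ^ 2 * (2 ^ 22 / (η * ε) ^ 22) * T ^ 22 := by gcongr
        _ = (Kd ^ 2 * 2 ^ 22 / η ^ 22) * (T / ε) ^ 22 := eA _
        _ ≤ Asat η * (T / ε) ^ 22 := mul_le_mul_of_nonneg_right hA2 hTε
  · -- `η ≥ 1/4`: the band condition is vacuous, take `P = p`
    push Not at hη1
    refine ⟨1, 1, one_pos, ?_⟩
    intro N T p ε hT hp hε hεV
    have hT' : (1 : ℝ) ≤ T := by exact_mod_cast hT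
    have hε1 : ε ≤ 1 / 4 := hεV.trans (boolVariance_le_quarter hp)
    have hTε : 1 ≤ (T : ℝ) / ε := by rw [le_div_iff₀ hε]; linarith
    refine ⟨N, T, p, hT, ?_, hp, ?_, fun j => ⟨j, ?_⟩⟩
    · rw [one_mul, pow_one, le_div_iff₀ hε]; nlinarith
    · linarith [boolVariance_nonneg p]
    · rw [one_mul, pow_one]
      exact le_mul_of_one_le_left (influence_nonneg j p) hTε

end Saturation

/-! ## §11 The crux is its top-band slice (kernel equivalence, conjecture-free) -/

/-- **PB-AA from TOP-BAND PB-AA** (the deciding implication of the cell node «CornerLift»; logic of CornerDial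
g19 `closes` with U = `varianceSaturation` plugged in): saturate `p` into the top band, take the influential
variable of the image, pull it back along the domination clause:
`Inf_i[p] ≥ (C / T'^c) / (A (T/ε)^a) ≥ (C / A^{c+1}) · (ε/T)^{a (c+1)}`. The conclusion is `Iff.rfl` to the
route decl `Theses.SosSandwich.PseudoBoundedAA`; the hypothesis is the corner normal form R (`TopBandPBAA` of
the cell memo). [folklore] -/
theorem pseudoBoundedAA_of_topBand :
    (∃ η : ℝ, 0 < η ∧ ∃ (c : ℕ) (C : ℝ), 0 < C ∧
      ∀ (N T : ℕ) (p : MvPolynomial (Fin N) ℝ), 1 ≤ T → PseudoBounded T p →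
        1 / 4 - η ≤ boolVariance p → ∃ i : Fin N, C / (T : ℝ) ^ c ≤ influence i p) →
    (∃ (c : ℕ) (C : ℝ), 0 < C ∧ ∀ (N T : ℕ) (p : MvPolynomial (Fin N) ℝ) (ε : ℝ), 1 ≤ T →
      PseudoBounded T p → 0 < ε → ε ≤ boolVariance p →
        ∃ i : Fin N, C * (ε / T) ^ c ≤ influence i p) := by
  intro hR
  obtain ⟨η, hη, c, C, hC, hR⟩ := hR
  obtain ⟨a, A, hA, hU⟩ := varianceSaturation η hη
  refine ⟨a * (c + 1), C / A ^ (c + 1), by positivity, ?_⟩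
  intro N T p ε hT hp hε hεv
  obtain ⟨N', T', P, hT'1, hT'le, hP, hvP, hdom⟩ := hU N T p ε hT hp hε hεv
  obtain ⟨j, hj⟩ := hR N' T' P hT'1 hP hvP
  obtain ⟨i, hi⟩ := hdom j
  refine ⟨i, ?_⟩
  have hT0 : (0 : ℝ) < (T : ℝ) := Nat.cast_pos.mpr (by omega)
  set M : ℝ := A * ((T : ℝ) / ε) ^ a with hM_def
  have hM : 0 < M := mul_pos hA (pow_pos (div_pos hT0 hε) a)
  have hT'0 : (0 : ℝ) < (T' : ℝ) := Nat.cast_pos.mpr (by omega)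
  have h1 : C / M ^ c ≤ C / (T' : ℝ) ^ c :=
    div_le_div_of_nonneg_left hC.le (pow_pos hT'0 c) (pow_le_pow_left₀ hT'0.le hT'le c)
  have h2 : C / M ^ c ≤ M * influence i p := h1.trans (hj.trans hi)
  have h3 : C / M ^ (c + 1) ≤ influence i p := by
    rw [pow_succ, ← div_div, div_le_iff₀ hM]
    linarith [h2, mul_comm M (influence i p)]
  have hMpow : M ^ (c + 1) = A ^ (c + 1) * ((T : ℝ) / ε) ^ (a * (c + 1)) := by
    rw [hM_def, mul_pow, ← pow_mul]
  have h4 : C / M ^ (c + 1) = C / A ^ (c + 1) * (ε / (T : ℝ)) ^ (a * (c + 1)) := by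
    rw [hMpow, ← div_div, div_eq_mul_inv (C / A ^ (c + 1)), ← inv_pow, inv_div]
  rw [← h4]
  exact h3

/-- **Necessity of the top-band slice**: PB-AA implies it (`η = 1/8`, `ε = 1/8`). [folklore] -/
theorem topBand_of_pseudoBoundedAA :
    (∃ (c : ℕ) (C : ℝ), 0 < C ∧ ∀ (N T : ℕ) (p : MvPolynomial (Fin N) ℝ) (ε : ℝ), 1 ≤ T →
      PseudoBounded T p → 0 < ε → ε ≤ boolVariance p →
        ∃ i : Fin N, C * (ε / T) ^ c ≤ influence i p) →
    (∃ η : ℝ, 0 < η ∧ ∃ (c : ℕ) (C : ℝ), 0 < C ∧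
      ∀ (N T : ℕ) (p : MvPolynomial (Fin N) ℝ), 1 ≤ T → PseudoBounded T p →
        1 / 4 - η ≤ boolVariance p → ∃ i : Fin N, C / (T : ℝ) ^ c ≤ influence i p) := by
  rintro ⟨c, C, hC, hX⟩
  refine ⟨1 / 8, by norm_num, c, C * (1 / 8) ^ c, by positivity, ?_⟩
  intro N T p hT hp hv
  obtain ⟨i, hi⟩ := hX N T p (1 / 8) hT hp (by norm_num) (by linarith)
  refine ⟨i, ?_⟩
  have : C * (1 / 8) ^ c / (T : ℝ) ^ c = C * (1 / 8 / (T : ℝ)) ^ c := by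
    rw [mul_div_assoc, ← div_pow]
  rw [this]
  exact hi

/-- **KERNEL EQUIVALENCE (conjecture-free)**: the rank-2 crux PB-AA (two parameters `T`, `ε`; `Iff.rfl` to
`Theses.SosSandwich.PseudoBoundedAA`) is EQUIVALENT to its one-parameter top-band slice — the Boolean-corner
normal form: WLOG `Var p ≥ 1/4 - η` for one fixed absolute `η > 0` (hence `E[p(1-p)] ≤ η`, `|E p - 1/2| ≤ √η`,
`nearCorner_of_topBand`). [folklore] -/
theorem pseudoBoundedAA_iff_topBand :
    (∃ (c : ℕ) (C : ℝ), 0 < C ∧ ∀ (N T : ℕ) (p : MvPolynomial (Fin N) ℝ) (ε : ℝ), 1 ≤ T →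
      PseudoBounded T p → 0 < ε → ε ≤ boolVariance p →
        ∃ i : Fin N, C * (ε / T) ^ c ≤ influence i p) ↔
    (∃ η : ℝ, 0 < η ∧ ∃ (c : ℕ) (C : ℝ), 0 < C ∧
      ∀ (N T : ℕ) (p : MvPolynomial (Fin N) ℝ), 1 ≤ T → PseudoBounded T p →
        1 / 4 - η ≤ boolVariance p → ∃ i : Fin N, C / (T : ℝ) ^ c ≤ influence i p) :=
  ⟨topBand_of_pseudoBoundedAA, pseudoBoundedAA_of_topBand⟩

/-! ## §12 The ledger item `stmt-QuantumAdvantage-27571` (U as served, inline vocabulary) -/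

set_option linter.style.longLine false in
/-- **Item `stmt-QuantumAdvantage-27571` PROVED** — the served signature of U (writer g7's cone-safe inline
re-spelling: `let ev / let avg`, inline SOS form of `PseudoBounded`; ONE line, verbatim from the ledger),
closed by `varianceSaturation` through the definitional junction (`PseudoBounded`, `evalBool`, `boolAvg`,
`boolVariance`, `influence`, `flipBit` are all `rfl`-transparent). [folklore] -/
theorem varianceSaturation_served :
    ∀ η : ℝ, 0 < η → ∃ (a : ℕ) (A : ℝ), 0 < A ∧ ∀ (N T : ℕ) (p : MvPolynomial (Fin N) ℝ) (ε : ℝ), let ev : MvPolynomial (Fin N) ℝ → (Fin N → Bool) → ℝ := fun f x => MvPolynomial.eval (fun k => if x k then (1 : ℝ) else 0) f; let avg : ((Fin N → Bool) → ℝ) → ℝ := fun g => (∑ x : Fin N → Bool, g x) / (2 : ℝ) ^ N; 1 ≤ T → (∃ (m : ℕ) (q r : Fin m → MvPolynomial (Fin N) ℝ), (∀ j, (q j).totalDegree ≤ T ∧ (r j).totalDegree ≤ T) ∧ ∀ x : Fin N → Bool, ev p x = ∑ j, ev (q j) x ^ 2 ∧ 1 - ev p x = ∑ j, ev (r j) x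 ^ 2) → 0 < ε → ε ≤ (avg fun x => (ev p x - avg (ev p)) ^ 2) → ∃ (N' T' : ℕ) (P : MvPolynomial (Fin N') ℝ), let ev' : MvPolynomial (Fin N') ℝ → (Fin N' → Bool) → ℝ := fun f x => MvPolynomial.eval (fun k => if x k then (1 : ℝ) else 0) f; let avg' : ((Fin N' → Bool) → ℝ) → ℝ := fun g => (∑ x : Fin N' → Bool, g x) / (2 : ℝ) ^ N'; 1 ≤ T' ∧ (T' : ℝ) ≤ A * ((T : ℝ) / ε) ^ a ∧ (∃ (m : ℕ) (q r : Fin m → MvPolynomial (Fin N') ℝ), (∀ j, (q j).totalDegree ≤ T' ∧ (r j).totalDegree ≤ T') ∧ ∀ x : Fin N' → Bool, ev' P x = ∑ j, ev' (q j) x ^ 2 ∧ 1 - ev' P x = ∑ j, ev' (r j) x ^ 2) ∧ 1 / 4 - η ≤ (avg' fun x => (ev' P x - avg' (ev' P)) ^ 2) ∧ ∀ j : Fin N', ∃ i : Fin N, (avg' fun x => (ev' P x - ev' P (Function.update x j (!x j))) ^ 2) ≤ A * ((T : ℝ) / ε) ^ a * (avg fun x => (ev p x - ev p (Function.update x i (!x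 i))) ^ 2) :=
  varianceSaturation

end Summit.QuantumAdvantage.QuantumAdvantage.Theorems.SosSandwich.CornerLift

end
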